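import Literature.Geometry.Lorentzian.SubdevelopmentUnionCauchy
import Literature.Geometry.Lorentzian.CommonDevelopmentProperExtension
import HarnessLib

/-!
# The extension step of Sbierski's Theorem 12: a common globally hyperbolic development enlarged
# by the development of a restarting hypersurface (assembly)

J. Sbierski, *On the existence of a maximal Cauchy development for the Einstein equations: a
dezornification*, Ann. Henri Poincaré 17 (2016) 301–329 = arXiv:1309.7591v3, §3.2, proof of
Theorem 12 (arXiv numbering; Ann. Henri Poincaré Thm. 3.5). After the analytic restart of the
local uniqueness theorem from the spacelike hypersurface `S ⊆ Ū` ("By Theorem 4 there exists a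
globally hyperbolic development `N ⊆ M` of `(S, ḡ_S, k_S)` together with an isometric embedding
`φ : N → M'` such that `φ|_S = ψ|_S`") and the agreement "`ψ = φ` in `N ∩ Ū`", the printed proof
concludes: *"we can extend `ψ` to an isometric embedding `Ψ : U ∪ N → M'` … `U ∪ N` is globally
hyperbolic with Cauchy hypersurface `ι(M̄)` … since `S` contains at least one point in `∂U`, it
follows that `U ∪ N ⊆ M` is a strictly larger CGHD of `M` and `M'` than the CGHD `U` we started
with."*

This file is that **assembly**, over the tree's realisation of common developments as open
subsets (`CauchyDevelopment.CommonDevelopment`, `CauchyDevelopment.IsCommonDevelopment`):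

* `CauchyDevelopment.CommonDevelopment.exists_isCommonDevelopment_lt_of_restart` — given a common
  development `(U, ψ)` of `𝒟`, `𝒟'`, an open `N ⊆ M`, a set `S' ⊆ closure U` with `S' ∩ N` a
  Cauchy hypersurface of `(N, g|_N, τ|_N)`, a time-orientation preserving isometric immersion
  `φ : (N, g|_N) → M'` agreeing with `ψ` on `U ∩ N`, and a point of `N` outside `U`, the open set
  `U ∪ N` is a common development strictly containing `U`: `ι(X)` is a Cauchy hypersurface of
  `U ∪ N` (`CommonDevelopment.isCauchyHypersurface_sup`, `SubdevelopmentUnionCauchy.lean`), and the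
  glued map `Ψ = ψ ∪ φ` is a smooth, time-orientation preserving isometric immersion with
  `Ψ ∘ ι = ι'` — local properties read off on the pieces `U`, `N` (as for the glued map of the
  MCGHD, `CauchyDevelopment.isCommonDevelopment_mcghd`);
* `sbierski_commonDevelopment_lt_of_restart` — hence the named fact
  `sbierski_commonDevelopment_lt_of_hasCorrespondingBoundaryPoints` (Sbierski's Thm. 12,
  `CommonDevelopmentProperExtension.lean`) **follows from the restart data alone**: for every
  common development with corresponding boundary points, SOME `N`, `S'`, `φ` as above. Producing
  them is the content of Lemmas 14–16, the level set `S = τ_q⁻¹(τ₀) ∩ W ∩ I⁺(ι(M̄))`, the local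
  existence and uniqueness theorem on `S` (Thm. 4 = the named fact
  `hawkingEllis_locallyUnique_vacuumDevelopment`) and the agreement `ψ = φ` on `N ∩ Ū` — not here.

Everything is proved; no definitions, no named facts (D-0026).

## References

* J. Sbierski, Ann. Henri Poincaré 17 (2016) 301–329 = arXiv:1309.7591v3, §3.2, proof of
  Thm. 12 (arXiv numbering), last two paragraphs. [Sbierski2016AHP]
* H. Ringström, *The Cauchy Problem in General Relativity*, EMS 2009, Ch. 23 (the same enlargement
  in the proof of the existence of the MGHD). [Ringstrom2009]
-/

noncomputable section

open Set Filter Function TopologicalSpace Topology Manifold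
open scoped Manifold ContDiff Topology

namespace Literature.Geometry.Lorentzian

universe u

section Developments

variable {n : ℕ} {X : Type u} [TopologicalSpace X] [ChartedSpace (EuclideanSpace ℝ (Fin n)) X]
  [IsManifold (𝓡 n) ∞ X] [ConnectedSpace X] {D : InitialDataSet (𝓡 n) X}

namespace CauchyDevelopment

namespace CommonDevelopment

variable {𝒟 𝒟' : CauchyDevelopment D} (𝔠 : CommonDevelopment 𝒟 𝒟')

/-- **The extension step of Sbierski's Theorem 12 (assembly).** Let `(U, ψ)` be a common globally
hyperbolic development of the Cauchy developments `𝒟 = (M, g, τ, ι)` and `𝒟' = (M', g', τ', ι')`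
of the same data, `N ⊆ M` open, `S' ⊆ closure U` a set such that `S' ∩ N` is a Cauchy
hypersurface of `(N, g|_N, τ|_N)`, and `φ : (N, g|_N, τ|_N) → (M', g', τ')` a time-orientation
preserving isometric immersion which agrees with `ψ` on `U ∩ N`. If `N ⊄ U`, then `U ∪ N` is a
common globally hyperbolic development of `𝒟` and `𝒟'` strictly larger than `U`: *"we can extend
`ψ` to an isometric embedding `Ψ : U ∪ N → M'` … `U ∪ N` is globally hyperbolic with Cauchy
hypersurface `ι(M̄)` … `U ∪ N ⊆ M` is a strictly larger CGHD of `M` and `M'` than the CGHD `U` we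
started with"* (Sbierski 2016, §3.2, end of the proof of Thm. 12). The Cauchy clause is
`CommonDevelopment.isCauchyHypersurface_sup`; smoothness, the isometry identity and the
preservation of the time orientation of the glued map are read off on the open pieces `U`, `N`.
[cite: Sbierski2016AHP, §3.2, proof of Thm. 12, last two paragraphs (arXiv numbering)] -/
theorem exists_isCommonDevelopment_lt_of_restart {N : Opens 𝒟.carrier} {S' : Set 𝒟.carrier}
    (hN : (𝒟.metric.restrict PseudoRiemannianMetric.contMDiff_restrict_holds N).IsCauchyHypersurface
      (𝒟.timeOrientation.restrict PseudoRiemannianMetric.contMDiff_restrict_holds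
        𝒟.timeOrientation.contMDiff_restrict_holds N) (Subtype.val ⁻¹' S'))
    (hS'U : S' ⊆ closure (𝔠.opens : Set 𝒟.carrier)) {φ : N → 𝒟'.carrier}
    (hφi : (𝒟.metric.restrict PseudoRiemannianMetric.contMDiff_restrict_holds N).IsIsometricImmersion
      𝒟'.metric.toPseudoRiemannianMetric φ)
    (hφτ : (𝒟.timeOrientation.restrict PseudoRiemannianMetric.contMDiff_restrict_holds
      𝒟.timeOrientation.contMDiff_restrict_holds N).PreservesTimeOrientation φ 𝒟'.timeOrientation)
    (hagree : ∀ (p : 𝒟.carrier) (hU : p ∈ 𝔠.opens) (hpN : p ∈ N), 𝔠.map ⟨p, hU⟩ = φ ⟨p, hpN⟩)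
    (hNU : ¬ ((N : Set 𝒟.carrier) ⊆ 𝔠.opens)) :
    ∃ V : Opens 𝒟.carrier, 𝒟.IsCommonDevelopment 𝒟'.toDataEmbedding V ∧ 𝔠.opens < V := by
  classical
  -- the glued map `Ψ = ψ ∪ φ`, as a map on all of `M` (junk off `U ∪ N`)
  set Φ : 𝒟.carrier → 𝒟'.carrier := fun p ↦
    if h : p ∈ 𝔠.opens then 𝔠.map ⟨p, h⟩ else
      if h' : p ∈ N then φ ⟨p, h'⟩ else 𝒟'.embed (Classical.arbitrary X) with hΦ_def
  have hΦU : ∀ (p : 𝒟.carrier) (hp : p ∈ 𝔠.opens), Φ p = 𝔠.map ⟨p, hp⟩ := fun p hp ↦ by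
    simp only [hΦ_def, dif_pos hp]
  have hΦN : ∀ (p : 𝒟.carrier) (hp : p ∈ N), Φ p = φ ⟨p, hp⟩ := fun p hp ↦ by
    by_cases hU : p ∈ 𝔠.opens
    · rw [hΦU p hU]
      exact hagree p hU hp
    · simp only [hΦ_def, dif_neg hU, dif_pos hp]
  have hΦU' : Φ ∘ (Subtype.val : 𝔠.opens → 𝒟.carrier) = 𝔠.map := funext fun y ↦ hΦU y.1 y.2
  have hΦN' : Φ ∘ (Subtype.val : N → 𝒟.carrier) = φ := funext fun y ↦ hΦN y.1 y.2
  -- smoothness of the glued map at the points of `U` and of `N`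
  have hsmU : ∀ (p : 𝒟.carrier) (hp : p ∈ 𝔠.opens),
      ContMDiffAt (𝓡 (n + 1)) (𝓡 (n + 1)) ∞ Φ p := fun p hp ↦ by
    have h : ContMDiffAt (𝓡 (n + 1)) (𝓡 (n + 1)) ∞ (fun y : 𝔠.opens ↦ Φ y) ⟨p, hp⟩ := by
      rw [show (fun y : 𝔠.opens ↦ Φ y) = 𝔠.map from hΦU']
      exact 𝔠.isIsometricImmersion.1 ⟨p, hp⟩
    exact contMDiffAt_subtype_iff.mp h
  have hsmN : ∀ (p : 𝒟.carrier) (hp : p ∈ N),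
      ContMDiffAt (𝓡 (n + 1)) (𝓡 (n + 1)) ∞ Φ p := fun p hp ↦ by
    have h : ContMDiffAt (𝓡 (n + 1)) (𝓡 (n + 1)) ∞ (fun y : N ↦ Φ y) ⟨p, hp⟩ := by
      rw [show (fun y : N ↦ Φ y) = φ from hΦN']
      exact hφi.1 ⟨p, hp⟩
    exact contMDiffAt_subtype_iff.mp h
  -- the differential of the glued map at the points of `U` and of `N`
  have hmfU : ∀ (p : 𝒟.carrier) (hp : p ∈ 𝔠.opens),
      mfderiv (𝓡 (n + 1)) (𝓡 (n + 1)) Φ p = mfderiv (𝓡 (n + 1)) (𝓡 (n + 1)) 𝔠.map ⟨p, hp⟩ :=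
    fun p hp ↦ by
      have hd : MDifferentiableAt (𝓡 (n + 1)) (𝓡 (n + 1)) Φ p :=
        (hsmU p hp).mdifferentiableAt (by simp)
      have h := mfderiv_comp_subtypeVal (I' := 𝓡 (n + 1)) (I := 𝓡 (n + 1)) (W := 𝔠.opens)
        (y := ⟨p, hp⟩) hd
      rw [hΦU'] at h
      exact h.symm
  have hmfN : ∀ (p : 𝒟.carrier) (hp : p ∈ N),
      mfderiv (𝓡 (n + 1)) (𝓡 (n + 1)) Φ p = mfderiv (𝓡 (n + 1)) (𝓡 (n + 1)) φ ⟨p, hp⟩ :=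
    fun p hp ↦ by
      have hd : MDifferentiableAt (𝓡 (n + 1)) (𝓡 (n + 1)) Φ p :=
        (hsmN p hp).mdifferentiableAt (by simp)
      have h := mfderiv_comp_subtypeVal (I' := 𝓡 (n + 1)) (I := 𝓡 (n + 1)) (W := N)
        (y := ⟨p, hp⟩) hd
      rw [hΦN'] at h
      exact h.symm
  -- the union `V = U ∪ N` and the glued map on it
  set V : Opens 𝒟.carrier := 𝔠.opens ⊔ N with hV_def
  have hdiffV : ∀ p : V, ContMDiffAt (𝓡 (n + 1)) (𝓡 (n + 1)) ∞ Φ p.1 := fun p ↦ by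
    rcases Opens.mem_sup.1 p.2 with hp | hp
    · exact hsmU p.1 hp
    · exact hsmN p.1 hp
  set Ψ : V → 𝒟'.carrier := Φ ∘ Subtype.val with hΨ_def
  have hmfV : ∀ p : V, mfderiv (𝓡 (n + 1)) (𝓡 (n + 1)) Ψ p =
      mfderiv (𝓡 (n + 1)) (𝓡 (n + 1)) Φ p.1 := fun p ↦
    mfderiv_comp_subtypeVal ((hdiffV p).mdifferentiableAt (by simp))
  refine ⟨V, ⟨fun x ↦ Opens.mem_sup.2 (Or.inl (𝔠.embed_mem x)), ?_, Ψ, ⟨fun p ↦ ?_, fun p ↦ ?_⟩,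
    fun p ↦ ?_, funext fun x ↦ ?_⟩, ?_⟩
  · -- `ι(X)` is a Cauchy hypersurface of `U ∪ N`
    exact 𝔠.isCauchyHypersurface_sup hN hS'U
  · -- smoothness
    exact contMDiffAt_subtype_iff.mpr (hdiffV p)
  · -- the isometry identity, on `U` and on `N`
    rcases Opens.mem_sup.1 p.2 with hp | hp
    · have h3 : Ψ p = 𝔠.map ⟨p.1, hp⟩ := hΦU p.1 hp
      ext v w
      rw [pullbackBilin_apply, hmfV p, hmfU p.1 hp, h3]
      have h4 := congrArg (fun b ↦ b v w) (𝔠.isIsometricImmersion.2 ⟨p.1, hp⟩)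
      simp only [pullbackBilin_apply] at h4
      exact h4
    · have h3 : Ψ p = φ ⟨p.1, hp⟩ := hΦN p.1 hp
      ext v w
      rw [pullbackBilin_apply, hmfV p, hmfN p.1 hp, h3]
      have h4 := congrArg (fun b ↦ b v w) (hφi.2 ⟨p.1, hp⟩)
      simp only [pullbackBilin_apply] at h4
      exact h4
  · -- time orientation, on `U` and on `N`
    change 𝒟'.timeOrientation.IsFutureDirected
      (mfderiv (𝓡 (n + 1)) (𝓡 (n + 1)) Ψ p (𝒟.timeOrientation.vectorField p.1))
    rcases Opens.mem_sup.1 p.2 with hp | hp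
    · have h3 : Ψ p = 𝔠.map ⟨p.1, hp⟩ := hΦU p.1 hp
      rw [hmfV p, hmfU p.1 hp, TimeOrientation.isFutureDirected_congr_point _ h3]
      exact 𝔠.preservesTimeOrientation ⟨p.1, hp⟩
    · have h3 : Ψ p = φ ⟨p.1, hp⟩ := hΦN p.1 hp
      rw [hmfV p, hmfN p.1 hp, TimeOrientation.isFutureDirected_congr_point _ h3]
      exact hφτ ⟨p.1, hp⟩
  · -- `Ψ ∘ ι = ι'`
    change Φ (𝒟.embed x) = 𝒟'.embed x
    rw [hΦU _ (𝔠.embed_mem x)]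
    exact 𝔠.map_embedOpens x
  · -- `U < U ∪ N`
    obtain ⟨p, hpN, hpU⟩ := Set.not_subset.1 hNU
    exact SetLike.lt_iff_le_and_exists.2 ⟨le_sup_left, p, Opens.mem_sup.2 (Or.inr hpN), hpU⟩

end CommonDevelopment

end CauchyDevelopment

end Developments

/-! ### Sbierski's Theorem 12 from the restart data -/

/-- **Sbierski's Theorem 12 follows from the restart data.** If for every common globally
hyperbolic development `(U, ψ)` of two vacuum developments of the same data having corresponding
boundary points there are an open `N ⊆ M`, a set `S' ⊆ closure U` with `S' ∩ N` a Cauchy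
hypersurface of `(N, g|_N, τ|_N)`, and a time-orientation preserving isometric immersion
`φ : (N, g|_N) → M'` agreeing with `ψ` on `U ∩ N`, with `N ⊄ U` — in the printed proof: `S'` the
level set `S = τ_q⁻¹(τ₀) ∩ W ∩ I⁺(ι(M̄)) ⊆ Ū` through a point of `∂U` (Lemmas 15, 16), `N` the
globally hyperbolic development of `(S, ḡ_S, k_S)` given by the local theory (Thm. 4) with its
isometric embedding `φ`, `φ|_S = ψ|_S` (Lemma 14), and "`ψ = φ` in `N ∩ Ū`" — then the named
fact `sbierski_commonDevelopment_lt_of_hasCorrespondingBoundaryPoints` (Sbierski 2016, Thm. 12)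
holds, by `CommonDevelopment.exists_isCommonDevelopment_lt_of_restart`.
[cite: Sbierski2016AHP, §3.2, Thm. 12 and its proof (arXiv numbering)] -/
theorem sbierski_commonDevelopment_lt_of_restart
    (hrestart : ∀ (N : Type) [TopologicalSpace N] [ChartedSpace (EuclideanSpace ℝ (Fin 3)) N]
      [IsManifold (𝓡 3) ∞ N] [ConnectedSpace N] (D₁ : InitialDataSet (𝓡 3) N)
      (𝒟₁ 𝒟₂ : VacuumCauchyDevelopment D₁)
      (𝔠 : CauchyDevelopment.CommonDevelopment 𝒟₁.toCauchyDevelopment 𝒟₂.toCauchyDevelopment),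
      𝔠.HasCorrespondingBoundaryPoints →
        ∃ (N' : Opens 𝒟₁.carrier) (S' : Set 𝒟₁.carrier) (φ : N' → 𝒟₂.carrier),
          (𝒟₁.metric.restrict PseudoRiemannianMetric.contMDiff_restrict_holds N').IsCauchyHypersurface
              (𝒟₁.timeOrientation.restrict PseudoRiemannianMetric.contMDiff_restrict_holds
                𝒟₁.timeOrientation.contMDiff_restrict_holds N') (Subtype.val ⁻¹' S') ∧
            S' ⊆ closure (𝔠.opens : Set 𝒟₁.carrier) ∧
            (𝒟₁.metric.restrict PseudoRiemannianMetric.contMDiff_restrict_holds N').IsIsometricImmersion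
              𝒟₂.metric.toPseudoRiemannianMetric φ ∧
            (𝒟₁.timeOrientation.restrict PseudoRiemannianMetric.contMDiff_restrict_holds
              𝒟₁.timeOrientation.contMDiff_restrict_holds N').PreservesTimeOrientation φ
                𝒟₂.timeOrientation ∧
            (∀ (p : 𝒟₁.carrier) (hU : p ∈ 𝔠.opens) (hpN : p ∈ N'),
              𝔠.map ⟨p, hU⟩ = φ ⟨p, hpN⟩) ∧
            ¬ ((N' : Set 𝒟₁.carrier) ⊆ 𝔠.opens)) :
    sbierski_commonDevelopment_lt_of_hasCorrespondingBoundaryPoints := by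
  intro N _ _ _ _ D₁ 𝒟₁ 𝒟₂ 𝔠 h𝔠
  obtain ⟨N', S', φ, hN', hS'U, hφi, hφτ, hagree, hNU⟩ := hrestart N D₁ 𝒟₁ 𝒟₂ 𝔠 h𝔠
  exact 𝔠.exists_isCommonDevelopment_lt_of_restart hN' hS'U hφi hφτ hagree hNU

end Literature.Geometry.Lorentzian

end
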